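import Literature.NumberTheory.Automorphic.QuaternionLocalSplitIdealCount
import HarnessLib

/-!
# The local Eichler order at a split prime: `(O₁ ∩ O₂)₍ₚ₎ = Ψ⁻¹ (ℤ_p, ℤ_p; p^e ℤ_p, ℤ_p)`
# (Vignéras, LNM 800, Ch. II §2 Thm. 2.3 (2) and Lemme 2.4; Cartan decomposition)

Topic `NumberTheory/Automorphic`; theorems only (no definition, no named fact, no instance).
For two maximal `ℤ`-orders `O₁, O₂` of a definite quaternion algebra `B` over `ℚ` and a prime
`p` with a matrix model `φ : B → M₂(ℚ_p)` (`QuaternionLocalSplit.lean`), there are a model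
`Ψ = k φ k⁻¹` and a level exponent `e ≥ 0` with

  `O₁,₍ₚ₎ = {x | Ψ(x) ∈ M₂(ℤ_p)}`,  `(O₁ ∩ O₂)₍ₚ₎ = {x | Ψ(x) ∈ M₂(ℤ_p), Ψ(x)₂₁ ∈ p^e ℤ_p}`

(`exists_eichler_model`): the **local Eichler order of level `p^e`** in its standard form
(Vignéras II §2: "`O = M(2,R) ∩ g M(2,R) g⁻¹ = (R, R; p^n R, R)`, `g = diag(1, p^n)`", Thm. 2.3
(2) and the definition of the Eichler orders of level `p^n`; Lemme 2.4). The two maximal orders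
are `Φ₁⁻¹(M₂(ℤ_p))` and `Φ₁⁻¹(g M₂(ℤ_p) g⁻¹)` for the conjugating matrix `g` between the two
models of `QuaternionLocalSplit.lean`, and the **Cartan decomposition**
`g = k₁ diag(p^a, p^b) k₂`, `kᵢ ∈ GL₂(ℤ_p)` (`exists_cartan`, elementary divisors of a `2 × 2`
matrix over `ℤ_p`: Vignéras II §2 proof of Thm. 2.3, "la théorie des diviseurs élémentaires")
puts the pair in standard relative position.

* `exists_cartan` — for `p`-integral `A` with `det A ≠ 0`: `k₁ A k₂ = diag(p^a, p^b)` with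
  `kᵢ ∈ GL₂(ℤ_p)`.
* `exists_eichler_model` — the displayed description, for `O₁, O₂` maximal.
* `localAt_inf_eq_localAt_iff_level_zero` — `e = 0 ↔ (O₁ ∩ O₂)₍ₚ₎ = O₁,₍ₚ₎`.

## References

* M.-F. Vignéras, *Arithmétique des algèbres de quaternions*, LNM 800 (1980), Ch. II §2
  Thm. 2.3 (2), Lemme 2.4 [VignerasLNM800].
* J. Voight, *Quaternion Algebras*, GTM 288 (2021), Prop. 23.4.3, 23.4.12.
-/

noncomputable section

open scoped TensorProduct Pointwise Matrix

universe u

namespace Literature.NumberTheory.Automorphic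

/-! ### `2 × 2` bookkeeping -/

section FinTwo

/-- Equality of `2 × 2` matrices from their four entries. [folklore] -/
theorem Matrix.fin_two_ext {α : Type*} {M N : Matrix (Fin 2) (Fin 2) α} (h00 : M 0 0 = N 0 0)
    (h01 : M 0 1 = N 0 1) (h10 : M 1 0 = N 1 0) (h11 : M 1 1 = N 1 1) : M = N := by
  ext i j
  fin_cases i <;> fin_cases j
  · exact h00
  · exact h01
  · exact h10
  · exact h11

variable {R : Type*} [CommRing R]

/-- The permutation matrix `w = (0, 1; 1, 0)` squares to `1`. [folklore] -/
theorem Matrix.swap_fin_two_mul_self : (!![(0 : R), 1; 1, 0]) * !![(0 : R), 1; 1, 0] = 1 := by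
  refine Matrix.fin_two_ext ?_ ?_ ?_ ?_ <;> simp [Matrix.mul_apply, Fin.sum_univ_two]

/-- Left multiplication by `w` swaps the rows. [folklore] -/
theorem Matrix.swap_mul_apply (A : Matrix (Fin 2) (Fin 2) R) (i j : Fin 2) :
    ((!![(0 : R), 1; 1, 0]) * A) i j = A (if i = 0 then 1 else 0) j := by
  fin_cases i <;> fin_cases j <;> simp [Matrix.mul_apply, Fin.sum_univ_two]

/-- Right multiplication by `w` swaps the columns. [folklore] -/
theorem Matrix.mul_swap_apply (A : Matrix (Fin 2) (Fin 2) R) (i j : Fin 2) :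
    (A * !![(0 : R), 1; 1, 0]) i j = A i (if j = 0 then 1 else 0) := by
  fin_cases i <;> fin_cases j <;> simp [Matrix.mul_apply, Fin.sum_univ_two]

end FinTwo

/-! ### Cartan decomposition in `GL₂(ℚ_p)` -/

section Cartan

variable {p : ℕ} [hp : Fact p.Prime]

/-- The permutation matrix `w` lies in `GL₂(ℤ_p)`. [folklore] -/
theorem swap_mem_padicGL2 : (!![(0 : ℚ_[p]), 1; 1, 0]) ∈ padicGL2 p := by
  refine ⟨fun i j => ?_, ?_⟩
  · fin_cases i <;> fin_cases j
    · show ‖(0 : ℚ_[p])‖ ≤ 1; rw [norm_zero]; exact zero_le_one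
    · show ‖(1 : ℚ_[p])‖ ≤ 1; rw [norm_one]
    · show ‖(1 : ℚ_[p])‖ ≤ 1; rw [norm_one]
    · show ‖(0 : ℚ_[p])‖ ≤ 1; rw [norm_zero]; exact zero_le_one
  · rw [Matrix.det_fin_two_of]; simp

/-- Conjugating (or multiplying) by elements of `GL₂(ℤ_p)` preserves `p`-integrality:
`M` is `p`-integral iff `k₁ M k₂` is, for `k₁, k₂ ∈ GL₂(ℤ_p)`. [folklore] -/
theorem integral_iff_of_mem_padicGL2 {k₁ k₂ M : Matrix (Fin 2) (Fin 2) ℚ_[p]} (hk₁ : k₁ ∈ padicGL2 p)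
    (hk₂ : k₂ ∈ padicGL2 p) : (∀ i j, ‖M i j‖ ≤ 1) ↔ ∀ i j, ‖(k₁ * M * k₂) i j‖ ≤ 1 := by
  constructor
  · intro h
    exact Padic.norm_mul_apply_le_one (Padic.norm_mul_apply_le_one hk₁.1 h) hk₂.1
  · intro h
    have : M = k₁⁻¹ * (k₁ * M * k₂) * k₂⁻¹ := by
      rw [Matrix.mul_assoc, Matrix.mul_assoc, mul_inv_of_mem_padicGL2 hk₂, Matrix.mul_one,
        ← Matrix.mul_assoc, inv_mul_of_mem_padicGL2 hk₁, Matrix.one_mul]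
    rw [this]
    exact Padic.norm_mul_apply_le_one (Padic.norm_mul_apply_le_one (inv_mem_padicGL2 hk₁).1 h)
      (inv_mem_padicGL2 hk₂).1

/-- **Cartan decomposition, pivot case**: a `p`-integral `A` with `det A ≠ 0` whose `(1,1)`
entry has maximal norm is `k₁⁻¹ diag(p^a, p^b) k₂⁻¹` with `kᵢ ∈ GL₂(ℤ_p)`. [cite: VignerasLNM800, Ch. II §2 proof of Thm. 2.3 (diviseurs élémentaires)] -/
theorem exists_cartan_of_pivot {A : Matrix (Fin 2) (Fin 2) ℚ_[p]} (hA : ∀ i j, ‖A i j‖ ≤ 1)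
    (hdet : A.det ≠ 0) (hmax : ∀ i j, ‖A i j‖ ≤ ‖A 0 0‖) :
    ∃ k₁ ∈ padicGL2 p, ∃ k₂ ∈ padicGL2 p, ∃ a b : ℕ,
      k₁ * A * k₂ = !![(p : ℚ_[p]) ^ a, 0; 0, (p : ℚ_[p]) ^ b] := by
  set x := A 0 0 with hx
  have hx0 : x ≠ 0 := by
    intro h
    have hall : ∀ i j, A i j = 0 := fun i j => by
      have := hmax i j; rw [h, norm_zero] at this; exact norm_le_zero_iff.mp this
    apply hdet
    rw [Matrix.det_fin_two, hall 0 0, hall 0 1]; ring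
  set r : ℚ_[p] := A 1 0 * x⁻¹ with hr
  set c : ℚ_[p] := A 0 1 * x⁻¹ with hc
  have hnx : 0 < ‖x‖ := norm_pos_iff.mpr hx0
  have hrn : ‖r‖ ≤ 1 := by
    rw [hr, norm_mul, norm_inv]; exact mul_inv_le_one_of_le₀ (hmax 1 0) (norm_nonneg _)
  have hcn : ‖c‖ ≤ 1 := by
    rw [hc, norm_mul, norm_inv]; exact mul_inv_le_one_of_le₀ (hmax 0 1) (norm_nonneg _)
  set w : ℚ_[p] := A 1 1 - r * A 0 1 with hw
  have hwn : ‖w‖ ≤ 1 := by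
    rw [hw, sub_eq_add_neg]
    refine (Padic.nonarchimedean _ _).trans (max_le (hA 1 1) ?_)
    rw [norm_neg, norm_mul]; exact mul_le_one₀ hrn (norm_nonneg _) (hA 0 1)
  -- `L A Rm = diag(x, w)`
  set L : Matrix (Fin 2) (Fin 2) ℚ_[p] := !![1, 0; -r, 1] with hL
  set Rm : Matrix (Fin 2) (Fin 2) ℚ_[p] := !![1, -c; 0, 1] with hRm
  have hLmem : L ∈ padicGL2 p := by
    refine ⟨fun i j => ?_, by rw [hL, Matrix.det_fin_two_of]; simp⟩
    fin_cases i <;> fin_cases j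
    · show ‖(1 : ℚ_[p])‖ ≤ 1; rw [norm_one]
    · show ‖(0 : ℚ_[p])‖ ≤ 1; rw [norm_zero]; exact zero_le_one
    · show ‖-r‖ ≤ 1; rw [norm_neg]; exact hrn
    · show ‖(1 : ℚ_[p])‖ ≤ 1; rw [norm_one]
  have hRmem : Rm ∈ padicGL2 p := by
    refine ⟨fun i j => ?_, by rw [hRm, Matrix.det_fin_two_of]; simp⟩
    fin_cases i <;> fin_cases j
    · show ‖(1 : ℚ_[p])‖ ≤ 1; rw [norm_one]
    · show ‖-c‖ ≤ 1; rw [norm_neg]; exact hcn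
    · show ‖(0 : ℚ_[p])‖ ≤ 1; rw [norm_zero]; exact zero_le_one
    · show ‖(1 : ℚ_[p])‖ ≤ 1; rw [norm_one]
  have hLAR : L * A * Rm = !![x, 0; 0, w] := by
    have h1 : A 1 0 = r * x := by rw [hr, mul_assoc, inv_mul_cancel₀ hx0, mul_one]
    have h2 : A 0 1 = c * x := by rw [hc, mul_assoc, inv_mul_cancel₀ hx0, mul_one]
    refine Matrix.fin_two_ext ?_ ?_ ?_ ?_ <;>
      simp only [hL, hRm, Matrix.mul_apply, Fin.sum_univ_two, Matrix.of_apply, Matrix.cons_val',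
        Matrix.cons_val_zero, Matrix.cons_val_one, Matrix.empty_val', Matrix.cons_val_fin_one]
    · rw [← hx]; ring
    · rw [← hx, h2]; ring
    · rw [← hx, h1]; ring
    · rw [← hx, h1, h2, hw, hr, h2]; field_simp; ring
  have hw0 : w ≠ 0 := by
    intro h0
    have hd : (L * A * Rm).det = 0 := by rw [hLAR, Matrix.det_fin_two_of, h0]; ring
    rw [Matrix.det_mul, Matrix.det_mul] at hd
    rcases mul_eq_zero.mp hd with hd | hd
    · rcases mul_eq_zero.mp hd with hd | hd
      · exact (isUnit_det_of_mem_padicGL2 hLmem).ne_zero hd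
      · exact hdet hd
    · exact (isUnit_det_of_mem_padicGL2 hRmem).ne_zero hd
  obtain ⟨a, u, hu, hxu, -⟩ := padic_exists_eq_pow_mul_of_norm_le_one hx0 (hA 0 0)
  obtain ⟨b, v, hv, hwv, -⟩ := padic_exists_eq_pow_mul_of_norm_le_one hw0 hwn
  have hu0 : u ≠ 0 := by intro h; rw [h, norm_zero] at hu; exact zero_ne_one hu
  have hv0 : v ≠ 0 := by intro h; rw [h, norm_zero] at hv; exact zero_ne_one hv
  set S : Matrix (Fin 2) (Fin 2) ℚ_[p] := !![u⁻¹, 0; 0, v⁻¹] with hS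
  have hSmem : S ∈ padicGL2 p := by
    refine ⟨fun i j => ?_, ?_⟩
    · fin_cases i <;> fin_cases j
      · show ‖u⁻¹‖ ≤ 1; rw [norm_inv, hu, inv_one]
      · show ‖(0 : ℚ_[p])‖ ≤ 1; rw [norm_zero]; exact zero_le_one
      · show ‖(0 : ℚ_[p])‖ ≤ 1; rw [norm_zero]; exact zero_le_one
      · show ‖v⁻¹‖ ≤ 1; rw [norm_inv, hv, inv_one]
    · rw [hS, Matrix.det_fin_two_of, mul_zero, sub_zero, norm_mul, norm_inv, norm_inv, hu, hv]; norm_num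
  refine ⟨S * L, mul_mem_padicGL2 hSmem hLmem, Rm, hRmem, a, b, ?_⟩
  rw [Matrix.mul_assoc S L A, Matrix.mul_assoc S (L * A) Rm, hLAR]
  refine Matrix.fin_two_ext ?_ ?_ ?_ ?_ <;>
    simp only [hS, Matrix.mul_apply, Fin.sum_univ_two, Matrix.of_apply, Matrix.cons_val',
      Matrix.cons_val_zero, Matrix.cons_val_one, Matrix.empty_val', Matrix.cons_val_fin_one]
  · rw [hxu]; field_simp; ring
  · ring
  · ring
  · rw [hwv]; field_simp; ring

/-- **Cartan decomposition for `2 × 2` matrices over `ℚ_p`**: a `p`-integral `A` with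
`det A ≠ 0` satisfies `k₁ A k₂ = diag(p^a, p^b)` for some `k₁, k₂ ∈ GL₂(ℤ_p)`, `a, b ∈ ℕ`
(bring an entry of maximal norm to the `(1,1)` position by permuting rows and columns, then
clear its row and column). [cite: VignerasLNM800, Ch. II §2 proof of Thm. 2.3 (diviseurs élémentaires)] -/
theorem exists_cartan {A : Matrix (Fin 2) (Fin 2) ℚ_[p]} (hA : ∀ i j, ‖A i j‖ ≤ 1) (hdet : A.det ≠ 0) :
    ∃ k₁ ∈ padicGL2 p, ∃ k₂ ∈ padicGL2 p, ∃ a b : ℕ,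
      k₁ * A * k₂ = !![(p : ℚ_[p]) ^ a, 0; 0, (p : ℚ_[p]) ^ b] := by
  classical
  set wm : Matrix (Fin 2) (Fin 2) ℚ_[p] := !![0, 1; 1, 0] with hwm
  have hwmem : wm ∈ padicGL2 p := swap_mem_padicGL2
  -- an entry of maximal norm
  obtain ⟨⟨i₀, j₀⟩, -, hm⟩ := Finset.exists_max_image (Finset.univ : Finset (Fin 2 × Fin 2))
    (fun ij => ‖A ij.1 ij.2‖) ⟨⟨0, 0⟩, Finset.mem_univ _⟩
  have hm' : ∀ i j, ‖A i j‖ ≤ ‖A i₀ j₀‖ := fun i j => hm ⟨i, j⟩ (Finset.mem_univ _)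
  -- permutation matrices bringing `(i₀, j₀)` to `(0, 0)`
  set P : Matrix (Fin 2) (Fin 2) ℚ_[p] := if i₀ = 0 then 1 else wm with hP
  set Q : Matrix (Fin 2) (Fin 2) ℚ_[p] := if j₀ = 0 then 1 else wm with hQ
  have hPmem : P ∈ padicGL2 p := by rw [hP]; split_ifs; exacts [one_mem_padicGL2, hwmem]
  have hQmem : Q ∈ padicGL2 p := by rw [hQ]; split_ifs; exacts [one_mem_padicGL2, hwmem]
  set A' := P * A * Q with hA'
  have hA'apply : ∀ i j, A' i j = A (if i₀ = 0 then i else (if i = 0 then 1 else 0))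
      (if j₀ = 0 then j else (if j = 0 then 1 else 0)) := by
    intro i j
    rw [hA', hP, hQ]
    by_cases hi : i₀ = 0 <;> by_cases hj : j₀ = 0 <;> simp only [hi, hj, if_true, if_false,
      Matrix.one_mul, Matrix.mul_one]
    · rw [Matrix.mul_swap_apply]
    · rw [Matrix.swap_mul_apply]
    · rw [Matrix.mul_assoc, Matrix.swap_mul_apply, Matrix.mul_swap_apply]
  have hA'int : ∀ i j, ‖A' i j‖ ≤ 1 := fun i j => by rw [hA'apply]; exact hA _ _
  have hA'00 : A' 0 0 = A i₀ j₀ := by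
    rw [hA'apply]
    congr 1
    · by_cases hi : i₀ = 0
      · rw [if_pos hi, hi]
      · rw [if_neg hi, if_pos rfl]
        fin_cases i₀ <;> simp_all
    · by_cases hj : j₀ = 0
      · rw [if_pos hj, hj]
      · rw [if_neg hj, if_pos rfl]
        fin_cases j₀ <;> simp_all
  have hA'max : ∀ i j, ‖A' i j‖ ≤ ‖A' 0 0‖ := fun i j => by
    rw [hA'00, hA'apply]; exact hm' _ _
  have hA'det : A'.det ≠ 0 := by
    rw [hA', Matrix.det_mul, Matrix.det_mul]
    exact mul_ne_zero (mul_ne_zero (isUnit_det_of_mem_padicGL2 hPmem).ne_zero hdet)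
      (isUnit_det_of_mem_padicGL2 hQmem).ne_zero
  obtain ⟨k₁, hk₁, k₂, hk₂, a, b, h⟩ := exists_cartan_of_pivot hA'int hA'det hA'max
  refine ⟨k₁ * P, mul_mem_padicGL2 hk₁ hPmem, Q * k₂, mul_mem_padicGL2 hQmem hk₂, a, b, ?_⟩
  rw [← h, hA']
  simp only [Matrix.mul_assoc]

/-- **Cartan decomposition for an invertible matrix over `ℚ_p`**: `k₁ g k₂ = diag(p^a, p^b)`
with `kᵢ ∈ GL₂(ℤ_p)` and `a, b ∈ ℤ`. [cite: VignerasLNM800, Ch. II §2 proof of Thm. 2.3 (diviseurs élémentaires)] -/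
theorem exists_cartan_zpow {g : Matrix (Fin 2) (Fin 2) ℚ_[p]} (hg : g.det ≠ 0) :
    ∃ k₁ ∈ padicGL2 p, ∃ k₂ ∈ padicGL2 p, ∃ a b : ℤ,
      k₁ * g * k₂ = !![(p : ℚ_[p]) ^ a, 0; 0, (p : ℚ_[p]) ^ b] := by
  have hpp : p.Prime := hp.out
  have hp0 : (p : ℚ_[p]) ≠ 0 := Nat.cast_ne_zero.mpr hpp.ne_zero
  -- clear denominators
  obtain ⟨t, ht⟩ : ∃ t : ℕ, ∀ i j, ‖g i j * (p : ℚ_[p]) ^ t‖ ≤ 1 := by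
    have h := fun ij : Fin 2 × Fin 2 => Padic.exists_norm_mul_pow_le_one (g ij.1 ij.2)
    choose c hc using h
    exact ⟨Finset.univ.sup c, fun i j =>
      Padic.norm_mul_pow_le_one_of_le (hc (i, j)) (Finset.le_sup (Finset.mem_univ _))⟩
  set A : Matrix (Fin 2) (Fin 2) ℚ_[p] := ((p : ℚ_[p]) ^ t) • g with hA
  have hAint : ∀ i j, ‖A i j‖ ≤ 1 := fun i j => by
    rw [hA, Matrix.smul_apply, smul_eq_mul, mul_comm]; exact ht i j
  have hAdet : A.det ≠ 0 := by
    rw [hA, Matrix.det_smul, Fintype.card_fin]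
    exact mul_ne_zero (pow_ne_zero _ (pow_ne_zero _ hp0)) hg
  obtain ⟨k₁, hk₁, k₂, hk₂, a, b, h⟩ := exists_cartan hAint hAdet
  refine ⟨k₁, hk₁, k₂, hk₂, (a : ℤ) - t, (b : ℤ) - t, ?_⟩
  have hscale : k₁ * g * k₂ = ((p : ℚ_[p]) ^ t)⁻¹ • (k₁ * A * k₂) := by
    rw [hA, Matrix.mul_smul, Matrix.smul_mul, smul_smul, inv_mul_cancel₀ (pow_ne_zero _ hp0), one_smul]
  rw [hscale, h]
  refine Matrix.fin_two_ext ?_ ?_ ?_ ?_ <;>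
    simp only [Matrix.smul_apply, smul_eq_mul, Matrix.of_apply, Matrix.cons_val', Matrix.cons_val_zero,
      Matrix.cons_val_one, Matrix.empty_val', Matrix.cons_val_fin_one, mul_zero]
  · rw [zpow_sub₀ hp0, zpow_natCast, zpow_natCast, div_eq_inv_mul]
  · rw [zpow_sub₀ hp0, zpow_natCast, zpow_natCast, div_eq_inv_mul]

end Cartan

/-! ### The Eichler pair in standard position -/

section EichlerModel

variable {B : Type u} [Ring B] [Algebra ℚ B] [IsQuaternionAlgebra ℚ B] {p : ℕ} [hp : Fact p.Prime]

/-- Conjugation by `diag(p^a, p^b)`: `diag⁻¹ M diag = (m₁₁, p^{b-a} m₁₂; p^{a-b} m₂₁, m₂₂)`. [folklore] -/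
theorem diag_zpow_inv_mul_mul_diag (a b : ℤ) (M : Matrix (Fin 2) (Fin 2) ℚ_[p]) :
    (!![(p : ℚ_[p]) ^ a, 0; 0, (p : ℚ_[p]) ^ b])⁻¹ * M * !![(p : ℚ_[p]) ^ a, 0; 0, (p : ℚ_[p]) ^ b] =
      !![M 0 0, (p : ℚ_[p]) ^ (b - a) * M 0 1; (p : ℚ_[p]) ^ (a - b) * M 1 0, M 1 1] := by
  have hp0 : (p : ℚ_[p]) ≠ 0 := Nat.cast_ne_zero.mpr hp.out.ne_zero
  have hpa : (p : ℚ_[p]) ^ a ≠ 0 := zpow_ne_zero _ hp0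
  have hpb : (p : ℚ_[p]) ^ b ≠ 0 := zpow_ne_zero _ hp0
  have hinv : (!![(p : ℚ_[p]) ^ a, 0; 0, (p : ℚ_[p]) ^ b])⁻¹ = !![((p : ℚ_[p]) ^ a)⁻¹, 0; 0, ((p : ℚ_[p]) ^ b)⁻¹] := by
    apply Matrix.inv_eq_left_inv
    refine Matrix.fin_two_ext ?_ ?_ ?_ ?_ <;>
      simp [Matrix.mul_apply, Fin.sum_univ_two, hpa, hpb]
  rw [hinv]
  refine Matrix.fin_two_ext ?_ ?_ ?_ ?_ <;>
    simp only [Matrix.mul_apply, Fin.sum_univ_two, Matrix.of_apply, Matrix.cons_val', Matrix.cons_val_zero,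
      Matrix.cons_val_one, Matrix.empty_val', Matrix.cons_val_fin_one, mul_zero, zero_mul, add_zero, zero_add]
  · field_simp
  · rw [zpow_sub₀ hp0]; field_simp
  · rw [zpow_sub₀ hp0]; field_simp
  · field_simp

/-- **The local Eichler order of a pair of maximal orders at a split prime, standard form**
(Vignéras II §2 Thm. 2.3 (2), Lemme 2.4; Voight Prop. 23.4.3): for maximal `ℤ`-orders
`O₁, O₂` of a division quaternion algebra `B` over `ℚ` and a matrix model `φ : B → M₂(ℚ_p)`,
there are a model `Ψ` (a conjugate of `φ`) and `e ∈ ℕ` with `O₁,₍ₚ₎ = Ψ⁻¹(M₂(ℤ_p))` and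
`(O₁ ∩ O₂)₍ₚ₎ = {x | Ψ(x) ∈ M₂(ℤ_p), ‖Ψ(x)₂₁‖ ≤ p^{-e}}`. [cite: VignerasLNM800, Ch. II §2 Thm. 2.3 (2) and Lemme 2.4] -/
theorem exists_eichler_model (hdiv : ∀ x : B, x ≠ 0 → IsUnit x) {O₁ O₂ : Submodule ℤ B}
    (hO₁ : IsMaximalZOrder O₁) (hO₂ : IsMaximalZOrder O₂) (φ : B →ₐ[ℚ] Matrix (Fin 2) (Fin 2) ℚ_[p]) :
    ∃ (Ψ : B →ₐ[ℚ] Matrix (Fin 2) (Fin 2) ℚ_[p]) (e : ℕ),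
      (∀ x : B, x ∈ localAt p O₁ ↔ ∀ i j, ‖Ψ x i j‖ ≤ 1) ∧
      (∀ x : B, x ∈ localAt p (O₁ ⊓ O₂) ↔ (∀ i j, ‖Ψ x i j‖ ≤ 1) ∧ ‖Ψ x 1 0‖ ≤ (p : ℝ) ^ (-(e : ℤ))) := by
  have hpp : p.Prime := hp.out
  have hp0 : (p : ℚ_[p]) ≠ 0 := Nat.cast_ne_zero.mpr hpp.ne_zero
  have hpR : (0 : ℝ) < p := by exact_mod_cast hpp.pos
  have hp1 : (1 : ℝ) < p := by exact_mod_cast hpp.one_lt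
  obtain ⟨u₁, hu₁⟩ := hO₁.exists_conjUnit_localAt_iff hdiv φ
  obtain ⟨u₂, hu₂⟩ := hO₂.exists_conjUnit_localAt_iff hdiv φ
  set Φ₁ := AlgHom.conjUnit φ u₁ with hΦ₁
  -- the matrices of the units
  set U₁ : Matrix (Fin 2) (Fin 2) ℚ_[p] := (u₁ : Matrix (Fin 2) (Fin 2) ℚ_[p]) with hU₁
  set U₁i : Matrix (Fin 2) (Fin 2) ℚ_[p] := ((u₁⁻¹ : (Matrix (Fin 2) (Fin 2) ℚ_[p])ˣ) : Matrix (Fin 2) (Fin 2) ℚ_[p])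
    with hU₁i
  set U₂ : Matrix (Fin 2) (Fin 2) ℚ_[p] := (u₂ : Matrix (Fin 2) (Fin 2) ℚ_[p]) with hU₂
  set U₂i : Matrix (Fin 2) (Fin 2) ℚ_[p] := ((u₂⁻¹ : (Matrix (Fin 2) (Fin 2) ℚ_[p])ˣ) : Matrix (Fin 2) (Fin 2) ℚ_[p])
    with hU₂i
  have h11 : U₁ * U₁i = 1 := by rw [hU₁, hU₁i]; exact Units.mul_inv u₁
  have h11' : U₁i * U₁ = 1 := by rw [hU₁, hU₁i]; exact Units.inv_mul u₁
  have h22 : U₂ * U₂i = 1 := by rw [hU₂, hU₂i]; exact Units.mul_inv u₂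
  have h22' : U₂i * U₂ = 1 := by rw [hU₂, hU₂i]; exact Units.inv_mul u₂
  have hΦ₁app : ∀ x, Φ₁ x = U₁i * φ x * U₁ := fun x => rfl
  have hΦ₂app : ∀ x, AlgHom.conjUnit φ u₂ x = U₂i * φ x * U₂ := fun x => rfl
  -- `u₂⁻¹ φ u₂ = g⁻¹ Φ₁ g` with `g = u₁⁻¹ u₂`
  set g : Matrix (Fin 2) (Fin 2) ℚ_[p] := U₁i * U₂ with hg
  have hgg : (U₂i * U₁) * g = 1 := by
    rw [hg, Matrix.mul_assoc, ← Matrix.mul_assoc U₁, h11, Matrix.one_mul, h22']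
  have hgdet : g.det ≠ 0 := by
    intro h0
    have := congrArg Matrix.det hgg
    rw [Matrix.det_mul, h0, mul_zero, Matrix.det_one] at this
    exact zero_ne_one this
  have hginv : g⁻¹ = U₂i * U₁ := Matrix.inv_eq_left_inv hgg
  have hconj₂ : ∀ x, AlgHom.conjUnit φ u₂ x = g⁻¹ * Φ₁ x * g := by
    intro x
    rw [hginv, hΦ₁app, hΦ₂app, hg]
    calc U₂i * φ x * U₂ = U₂i * ((U₁ * U₁i) * φ x * (U₁ * U₁i)) * U₂ := by
          rw [h11, Matrix.one_mul, Matrix.mul_one]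
      _ = U₂i * U₁ * (U₁i * φ x * U₁) * (U₁i * U₂) := by simp only [Matrix.mul_assoc]
  -- Cartan: `k₁ g k₂ = D`
  obtain ⟨k₁, hk₁, k₂, hk₂, a, b, hcartan⟩ := exists_cartan_zpow hgdet
  set D : Matrix (Fin 2) (Fin 2) ℚ_[p] := !![(p : ℚ_[p]) ^ a, 0; 0, (p : ℚ_[p]) ^ b] with hD
  have hgeq : g = k₁⁻¹ * D * k₂⁻¹ := by
    rw [← hcartan, Matrix.mul_assoc, Matrix.mul_assoc, mul_inv_of_mem_padicGL2 hk₂, Matrix.mul_one,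
      ← Matrix.mul_assoc, inv_mul_of_mem_padicGL2 hk₁, Matrix.one_mul]
  have hDdet : D.det ≠ 0 := by
    rw [hD, Matrix.det_fin_two_of, mul_zero, sub_zero]
    exact mul_ne_zero (zpow_ne_zero _ hp0) (zpow_ne_zero _ hp0)
  have hDu : IsUnit D.det := isUnit_iff_ne_zero.mpr hDdet
  have hk₁u : IsUnit k₁.det := isUnit_det_of_mem_padicGL2 hk₁
  have hk₂u : IsUnit k₂.det := isUnit_det_of_mem_padicGL2 hk₂
  have hginv' : g⁻¹ = k₂ * D⁻¹ * k₁ := by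
    apply Matrix.inv_eq_left_inv
    rw [hgeq]
    calc k₂ * D⁻¹ * k₁ * (k₁⁻¹ * D * k₂⁻¹)
        = k₂ * (D⁻¹ * ((k₁ * k₁⁻¹) * D) * k₂⁻¹) := by simp only [Matrix.mul_assoc]
      _ = 1 := by
        rw [Matrix.mul_nonsing_inv k₁ hk₁u, Matrix.one_mul, Matrix.nonsing_inv_mul D hDu, Matrix.one_mul,
          Matrix.mul_nonsing_inv k₂ hk₂u]
  -- the model `Ψ = k₁ Φ₁ k₁⁻¹`, as the conjugate of `Φ₁` by the unit `k₁⁻¹`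
  set k₁U : (Matrix (Fin 2) (Fin 2) ℚ_[p])ˣ := ((Matrix.isUnit_iff_isUnit_det k₁).mpr hk₁u).unit with hk₁U
  have hk₁Uval : (k₁U : Matrix (Fin 2) (Fin 2) ℚ_[p]) = k₁ := IsUnit.unit_spec _
  have hk₁Uinv : ((k₁U⁻¹ : (Matrix (Fin 2) (Fin 2) ℚ_[p])ˣ) : Matrix (Fin 2) (Fin 2) ℚ_[p]) = k₁⁻¹ := by
    rw [Matrix.coe_units_inv, hk₁Uval]
  set Ψ₀ := AlgHom.conjUnit Φ₁ k₁U⁻¹ with hΨ₀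
  have hΨ₀app : ∀ x, Ψ₀ x = k₁ * Φ₁ x * k₁⁻¹ := by
    intro x; rw [hΨ₀, AlgHom.conjUnit_apply, inv_inv, hk₁Uval, hk₁Uinv]
  -- `O₁,₍ₚ₎` through `Ψ₀`
  have hΛ₁ : ∀ x, x ∈ localAt p O₁ ↔ ∀ i j, ‖Ψ₀ x i j‖ ≤ 1 := by
    intro x
    rw [hu₁]
    rw [integral_iff_of_mem_padicGL2 hk₁ (inv_mem_padicGL2 hk₁)]
    simp only [hΨ₀app]
  -- `O₂,₍ₚ₎` through `Ψ₀`: `D⁻¹ Ψ₀ D` integral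
  have hΛ₂ : ∀ x, x ∈ localAt p O₂ ↔ ∀ i j, ‖(D⁻¹ * Ψ₀ x * D) i j‖ ≤ 1 := by
    intro x
    rw [hu₂]
    rw [hconj₂, hginv', hgeq, integral_iff_of_mem_padicGL2 (inv_mem_padicGL2 hk₂) hk₂]
    have : k₂⁻¹ * (k₂ * D⁻¹ * k₁ * Φ₁ x * (k₁⁻¹ * D * k₂⁻¹)) * k₂ = D⁻¹ * Ψ₀ x * D := by
      rw [hΨ₀app]
      calc k₂⁻¹ * (k₂ * D⁻¹ * k₁ * Φ₁ x * (k₁⁻¹ * D * k₂⁻¹)) * k₂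
          = (k₂⁻¹ * k₂) * (D⁻¹ * (k₁ * Φ₁ x * k₁⁻¹) * D) * (k₂⁻¹ * k₂) := by simp only [Matrix.mul_assoc]
        _ = D⁻¹ * (k₁ * Φ₁ x * k₁⁻¹) * D := by
          rw [Matrix.nonsing_inv_mul k₂ hk₂u, Matrix.one_mul, Matrix.mul_one]
    rw [this]
  -- the two orientations
  rcases le_or_gt a b with hab | hab
  · -- `a ≤ b`: level `e = b - a`, condition on the `(1,0)` entry
    refine ⟨Ψ₀, (b - a).toNat, hΛ₁, fun x => ?_⟩
    rw [localAt_inf, Submodule.mem_inf, hΛ₁, hΛ₂, hD, diag_zpow_inv_mul_mul_diag]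
    have he : (((b - a).toNat : ℕ) : ℤ) = b - a := Int.toNat_of_nonneg (by omega)
    constructor
    · rintro ⟨h1, h2⟩
      refine ⟨h1, ?_⟩
      have h := h2 1 0
      simp only [Matrix.of_apply, Matrix.cons_val', Matrix.cons_val_zero, Matrix.cons_val_one,
        Matrix.empty_val', Matrix.cons_val_fin_one] at h
      rw [norm_mul, Padic.norm_p_zpow] at h
      rw [he]
      have hpow : (0 : ℝ) < (p : ℝ) ^ (-(a - b)) := zpow_pos hpR _
      calc ‖Ψ₀ x 1 0‖ = ((p : ℝ) ^ (-(a - b)))⁻¹ * ((p : ℝ) ^ (-(a - b)) * ‖Ψ₀ x 1 0‖) := by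
            rw [← mul_assoc, inv_mul_cancel₀ hpow.ne', one_mul]
        _ ≤ ((p : ℝ) ^ (-(a - b)))⁻¹ * 1 := mul_le_mul_of_nonneg_left h (inv_nonneg.mpr hpow.le)
        _ = (p : ℝ) ^ (-(b - a)) := by rw [mul_one, ← zpow_neg]; congr 1; ring
    · rintro ⟨h1, h2⟩
      refine ⟨h1, fun i j => ?_⟩
      rw [he] at h2
      fin_cases i <;> fin_cases j
      · show ‖Ψ₀ x 0 0‖ ≤ 1; exact h1 0 0
      · show ‖(p : ℚ_[p]) ^ (b - a) * Ψ₀ x 0 1‖ ≤ 1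
        rw [norm_mul, Padic.norm_p_zpow]
        exact mul_le_one₀ (zpow_le_one_of_nonpos₀ hp1.le (by omega)) (norm_nonneg _) (h1 0 1)
      · show ‖(p : ℚ_[p]) ^ (a - b) * Ψ₀ x 1 0‖ ≤ 1
        rw [norm_mul, Padic.norm_p_zpow]
        have hpow : (0 : ℝ) < (p : ℝ) ^ (-(a - b)) := zpow_pos hpR _
        calc (p : ℝ) ^ (-(a - b)) * ‖Ψ₀ x 1 0‖ ≤ (p : ℝ) ^ (-(a - b)) * (p : ℝ) ^ (-(b - a)) :=
              mul_le_mul_of_nonneg_left h2 hpow.le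
          _ = 1 := by rw [← zpow_add₀ hpR.ne']; convert zpow_zero (p : ℝ) using 2; ring
      · show ‖Ψ₀ x 1 1‖ ≤ 1; exact h1 1 1
  · -- `b < a`: conjugate by the swap `w` to move the condition to the `(1,0)` entry
    set wU : (Matrix (Fin 2) (Fin 2) ℚ_[p])ˣ :=
      ((Matrix.isUnit_iff_isUnit_det _).mpr (isUnit_det_of_mem_padicGL2 (swap_mem_padicGL2 (p := p)))).unit
      with hwU
    have hwUval : (wU : Matrix (Fin 2) (Fin 2) ℚ_[p]) = !![0, 1; 1, 0] := IsUnit.unit_spec _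
    have hwUinv : ((wU⁻¹ : (Matrix (Fin 2) (Fin 2) ℚ_[p])ˣ) : Matrix (Fin 2) (Fin 2) ℚ_[p]) = !![0, 1; 1, 0] := by
      rw [Matrix.coe_units_inv, hwUval]
      apply Matrix.inv_eq_left_inv
      exact Matrix.swap_fin_two_mul_self
    set Ψ := AlgHom.conjUnit Ψ₀ wU with hΨ
    have hΨapp : ∀ x i j, Ψ x i j = Ψ₀ x (if i = 0 then 1 else 0) (if j = 0 then 1 else 0) := by
      intro x i j
      rw [hΨ, AlgHom.conjUnit_apply, hwUval, hwUinv, Matrix.mul_swap_apply, Matrix.swap_mul_apply]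
    have hΨint : ∀ x, (∀ i j, ‖Ψ₀ x i j‖ ≤ 1) ↔ ∀ i j, ‖Ψ x i j‖ ≤ 1 := by
      intro x
      constructor
      · intro h i j; rw [hΨapp]; exact h _ _
      · intro h i j
        have := h (if i = 0 then 1 else 0) (if j = 0 then 1 else 0)
        rw [hΨapp] at this
        convert this using 3 <;> split_ifs with h' <;> omega
    refine ⟨Ψ, (a - b).toNat, fun x => (hΛ₁ x).trans (hΨint x), fun x => ?_⟩
    rw [localAt_inf, Submodule.mem_inf, hΛ₁, hΛ₂, hD, diag_zpow_inv_mul_mul_diag, hΨint]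
    have he : (((a - b).toNat : ℕ) : ℤ) = a - b := Int.toNat_of_nonneg (by omega)
    have hΨ10 : Ψ x 1 0 = Ψ₀ x 0 1 := by rw [hΨapp]; rfl
    constructor
    · rintro ⟨h1, h2⟩
      refine ⟨h1, ?_⟩
      have h := h2 0 1
      simp only [Matrix.of_apply, Matrix.cons_val', Matrix.cons_val_zero, Matrix.cons_val_one,
        Matrix.empty_val', Matrix.cons_val_fin_one] at h
      rw [norm_mul, Padic.norm_p_zpow] at h
      rw [he, hΨ10]
      have hpow : (0 : ℝ) < (p : ℝ) ^ (-(b - a)) := zpow_pos hpR _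
      calc ‖Ψ₀ x 0 1‖ = ((p : ℝ) ^ (-(b - a)))⁻¹ * ((p : ℝ) ^ (-(b - a)) * ‖Ψ₀ x 0 1‖) := by
            rw [← mul_assoc, inv_mul_cancel₀ hpow.ne', one_mul]
        _ ≤ ((p : ℝ) ^ (-(b - a)))⁻¹ * 1 := mul_le_mul_of_nonneg_left h (inv_nonneg.mpr hpow.le)
        _ = (p : ℝ) ^ (-(a - b)) := by rw [mul_one, ← zpow_neg]; congr 1; ring
    · rintro ⟨h1, h2⟩
      have h1' : ∀ i j, ‖Ψ₀ x i j‖ ≤ 1 := (hΨint x).mpr h1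
      refine ⟨h1, fun i j => ?_⟩
      rw [he, hΨ10] at h2
      fin_cases i <;> fin_cases j
      · show ‖Ψ₀ x 0 0‖ ≤ 1; exact h1' 0 0
      · show ‖(p : ℚ_[p]) ^ (b - a) * Ψ₀ x 0 1‖ ≤ 1
        rw [norm_mul, Padic.norm_p_zpow]
        have hpow : (0 : ℝ) < (p : ℝ) ^ (-(b - a)) := zpow_pos hpR _
        calc (p : ℝ) ^ (-(b - a)) * ‖Ψ₀ x 0 1‖ ≤ (p : ℝ) ^ (-(b - a)) * (p : ℝ) ^ (-(a - b)) :=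
              mul_le_mul_of_nonneg_left h2 hpow.le
          _ = 1 := by rw [← zpow_add₀ hpR.ne']; convert zpow_zero (p : ℝ) using 2; ring
      · show ‖(p : ℚ_[p]) ^ (a - b) * Ψ₀ x 1 0‖ ≤ 1
        rw [norm_mul, Padic.norm_p_zpow]
        exact mul_le_one₀ (zpow_le_one_of_nonpos₀ hp1.le (by omega)) (norm_nonneg _) (h1' 1 0)
      · show ‖Ψ₀ x 1 1‖ ≤ 1; exact h1' 1 1

end EichlerModel

end Literature.NumberTheory.Automorphic
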